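import Mathlib.Analysis.SpecialFunctions.BinaryEntropy
import Mathlib.Analysis.SpecialFunctions.Pow.Real
import Literature.InformationTheory.QuantumCodes.QuantumGilbertVarshamov
import HarnessLib

/-!
# The asymptotic quantum Gilbert–Varshamov bound `R = 1 − δ log₂ 3 − H₂(δ)`
# (Calderbank–Rains–Shor–Sloane 1997, Theorem 2; Gottesman 1997, §7.1)

Topic `Literature/InformationTheory/QuantumCodes` (LADDER-QEC, LIT-1 custody: LOWER-bound column,
asymptotic form). Everything here is PROVED (no named facts). Kept in its own leaf so that the finite
file `QuantumGilbertVarshamov.lean` stays free of real analysis.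

**Sources.**
* A. R. Calderbank, E. M. Rains, P. W. Shor, N. J. A. Sloane, *Quantum error correction and orthogonal
  geometry*, Phys. Rev. Lett. 78 (1997) 405 = arXiv:quant-ph/9605005 [CalderbankEtAl1997], Theorem 2
  (held text chunk p0005 L104–112): «There exist quantum error-correcting codes with asymptotic rate
  `R = 1 − 2δ log₂ 3 − H₂(2δ)` where `δ` is the fraction of qubits that are subject to decoherence and
  `H₂` … is the binary entropy function» (proved there by the counting argument formalised in
  `QuantumGilbertVarshamov.lean`; the codes correct `δn` errors, i.e. have minimum distance `≈ 2δn`).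
* D. Gottesman, *Stabilizer Codes and Quantum Error Correction*, Caltech thesis 1997 =
  arXiv:quant-ph/9705052 [Gottesman1997], §7.1 (chunk p0055 L118–127): the quantum Gilbert–Varshamov
  bound `Σ_{j=0}^{d−1} 3^j C(n,j) 2^k ≥ 2ⁿ` and «In the limit where `t = pn = d/2`, with `n` large,
  this becomes `k/n ≥ 1 − 2p log₂ 3 − H(2p)`».
* The volume estimate `Σ_{i=1}^{⌊nδ⌋} C(n,i)(q−1)^i ≤ q^{n h_q(δ)}` (`0 ≤ δ ≤ 1 − 1/q`,
  `h_q(δ) = δ log_q(q−1) − δ log_q δ − (1−δ) log_q(1−δ)`) as printed in [Matsumoto2017, §2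
  (chunk p0004)] (attributed to MacWilliams–Sloane) and [Vanlint1992, (5.1.4)–(5.1.6) (p0119)];
  used here at `q − 1 = 3` (one `X/Y/Z` letter per position).

**What is proved** (entropies in nats, Mathlib's `Real.binEntropy`; `δ = d/n` is the RELATIVE
DISTANCE, i.e. the printed `2δ` / `2p`):

* `sum_choose_mul_three_pow_le_exp` — for `0 ≤ λ ≤ 3/4`:
  `Σ_{i ≤ ⌊λn⌋} C(n,i)·3^i ≤ exp(n·(binEntropy λ + λ log 3))` (van Lint's one-line argument with the
  weights `C(n,i) λ^i (1−λ)^{n−i}`, `(λ/3)^i ≥ (λ/3)^{λn}(1−λ)^{i−λn}` for `λ ≤ 3(1−λ)`);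
* **`quantumGilbertVarshamov_asymptotic`** — if `0 ≤ δ ≤ 3/4`, `0 ≤ R` and
  `binEntropy δ + δ·log 3 ≤ (1 − R)·log 2` (i.e. `R ≤ 1 − δ log₂ 3 − H₂(δ)`), then for EVERY `n` a pure
  `[[n, ⌊Rn⌋, ⌈δn⌉]]` stabilizer code exists (the finite bound `quantumGilbertVarshamov` holds at
  every length once the rate is below the GV curve — no limit is needed);
* `CalderbankEtAl1997_theorem2` — the printed parametrisation by the error fraction `p = δ/2`:
  `binEntropy (2p) + 2p·log 3 ≤ (1 − R) log 2`, `0 ≤ p ≤ 3/8` ⇒ pure `[[n, ⌊Rn⌋, ⌈2pn⌉]]` for all `n`.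

## Tree / Mathlib search

`rg binEntropy Literature/InformationTheory` (2026-08-27): no asymptotic quantum GV statement
(classical: `Coding/GilbertVarshamovDualBinary.lean`; binary volume bound
`Literature.Combinatorics.vanLint_sum_choose_le_exp_binEntropy`, whose proof is mirrored here with
the weight `3^i`). Reused: `quantumGilbertVarshamov` (`QuantumGilbertVarshamov.lean`).
-/

namespace Literature.InformationTheory.QuantumCodes

open Finset Real

/-! ### The `q = 4` volume estimate -/

/-- The weight inequality behind the volume estimate: for `0 < λ ≤ 3/4` and `i ≤ λn`,
`exp(−n(H(λ) + λ log 3)) · 3^i ≤ λ^i (1−λ)^{n−i}` (the ratio `λ/(3(1−λ)) ≤ 1` raised to a power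
`i ≤ λn`). [cite: Vanlint1992, Theorem 1.4.5 (i) proof (p. 67) and (5.1.6) (p0119)] -/
private theorem exp_neg_le_weight {n i : ℕ} {l : ℝ} (h0 : 0 < l) (h1 : l ≤ 3 / 4)
    (hin : i ≤ n) (hi : (i : ℝ) ≤ l * n) :
    Real.exp (-(n * (binEntropy l + l * Real.log 3))) * (3 : ℝ) ^ i ≤ l ^ i * (1 - l) ^ (n - i) := by
  have hq : 0 < 1 - l := by linarith
  set r := l / (3 * (1 - l)) with hr
  have hr0 : 0 < r := div_pos h0 (by linarith)
  have hr1 : r ≤ 1 := by rw [hr, div_le_one (by linarith)]; linarith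
  -- the weight as `(1 - l)^n * r^i * 3^i`
  have hw : l ^ i * (1 - l) ^ (n - i) = (1 - l) ^ n * r ^ (i : ℝ) * (3 : ℝ) ^ i := by
    rw [Real.rpow_natCast, hr, div_pow, mul_pow]
    have : (1 - l) ^ n = (1 - l) ^ (n - i) * (1 - l) ^ i := by
      rw [← pow_add, Nat.sub_add_cancel hin]
    rw [this]
    field_simp
  rw [hw]
  have hmono : r ^ (l * n) ≤ r ^ (i : ℝ) := Real.rpow_le_rpow_of_exponent_ge hr0 hr1 hi
  have hclosed : Real.exp (-(n * (binEntropy l + l * Real.log 3))) = (1 - l) ^ n * r ^ (l * n) := by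
    rw [← Real.rpow_natCast (1 - l) n, Real.rpow_def_of_pos hq, Real.rpow_def_of_pos hr0,
      ← Real.exp_add]
    congr 1
    have hlr : Real.log r = Real.log l - (Real.log 3 + Real.log (1 - l)) := by
      rw [hr, Real.log_div h0.ne' (mul_ne_zero (by norm_num) hq.ne'), Real.log_mul (by norm_num) hq.ne']
    rw [hlr]
    simp only [binEntropy, Real.log_inv]
    ring
  rw [hclosed]
  have h3i : (0 : ℝ) ≤ (3 : ℝ) ^ i := by positivity
  exact mul_le_mul_of_nonneg_right (mul_le_mul_of_nonneg_left hmono (pow_nonneg hq.le n)) h3i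

/-- **The `q = 4` Hamming-ball volume estimate**: for `0 ≤ λ ≤ 3/4`,
`Σ_{i ≤ ⌊λn⌋} C(n,i)·3^i ≤ exp(n·(binEntropy λ + λ·log 3)) = 4^{n h₄(λ)}`.
[cite: Matsumoto2017, §2 (chunk p0004: "for 0 ≤ δ ≤ 1−1/q we have Σ_{i=1}^{⌊nδ⌋} C(n,i)(q−1)^i ≤ q^{n h_q(δ)}"); Vanlint1992, (5.1.4)–(5.1.6) (p0119)] -/
theorem sum_choose_mul_three_pow_le_exp (n : ℕ) {l : ℝ} (h0 : 0 ≤ l) (h1 : l ≤ 3 / 4) :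
    (∑ i ∈ range (⌊l * n⌋₊ + 1), (n.choose i : ℝ) * (3 : ℝ) ^ i) ≤
      Real.exp (n * (binEntropy l + l * Real.log 3)) := by
  rcases h0.eq_or_lt with rfl | h0
  · simp
  set m := ⌊l * n⌋₊ with hm
  have hmn : m ≤ n := by
    refine Nat.floor_le_of_le ?_
    calc l * (n : ℝ) ≤ 1 * (n : ℝ) := by gcongr; linarith
      _ = n := one_mul _
  have hbin : ∑ i ∈ range (n + 1), l ^ i * (1 - l) ^ (n - i) * (n.choose i : ℝ) = 1 := by
    have := (add_pow l (1 - l) n).symm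
    rwa [add_sub_cancel, one_pow] at this
  have hsub : ∑ i ∈ range (m + 1), l ^ i * (1 - l) ^ (n - i) * (n.choose i : ℝ) ≤ 1 := by
    calc ∑ i ∈ range (m + 1), l ^ i * (1 - l) ^ (n - i) * (n.choose i : ℝ)
        ≤ ∑ i ∈ range (n + 1), l ^ i * (1 - l) ^ (n - i) * (n.choose i : ℝ) := by
          apply Finset.sum_le_sum_of_subset_of_nonneg (Finset.range_subset_range.2 (by omega))
          intro i _ _
          have : 0 ≤ 1 - l := by linarith
          positivity
      _ = 1 := hbin
  have hlow : Real.exp (-(n * (binEntropy l + l * Real.log 3))) *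
      ∑ i ∈ range (m + 1), (n.choose i : ℝ) * (3 : ℝ) ^ i ≤
      ∑ i ∈ range (m + 1), l ^ i * (1 - l) ^ (n - i) * (n.choose i : ℝ) := by
    rw [mul_sum]
    refine sum_le_sum fun i hi => ?_
    rw [mem_range] at hi
    have hin : i ≤ n := by omega
    have hi' : (i : ℝ) ≤ l * n := by
      have : i ≤ m := by omega
      exact (Nat.cast_le.2 this).trans (Nat.floor_le (by positivity))
    have := exp_neg_le_weight h0 h1 hin hi'
    calc Real.exp (-(n * (binEntropy l + l * Real.log 3))) * ((n.choose i : ℝ) * (3 : ℝ) ^ i)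
        = (Real.exp (-(n * (binEntropy l + l * Real.log 3))) * (3 : ℝ) ^ i) * (n.choose i : ℝ) := by
          ring
      _ ≤ l ^ i * (1 - l) ^ (n - i) * (n.choose i : ℝ) :=
          mul_le_mul_of_nonneg_right this (Nat.cast_nonneg _)
  have key : Real.exp (-(n * (binEntropy l + l * Real.log 3))) *
      ∑ i ∈ range (m + 1), (n.choose i : ℝ) * (3 : ℝ) ^ i ≤ 1 := hlow.trans hsub
  calc ∑ i ∈ range (m + 1), (n.choose i : ℝ) * (3 : ℝ) ^ i
      = Real.exp (n * (binEntropy l + l * Real.log 3)) *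
          (Real.exp (-(n * (binEntropy l + l * Real.log 3))) *
            ∑ i ∈ range (m + 1), (n.choose i : ℝ) * (3 : ℝ) ^ i) := by
        rw [← mul_assoc, ← Real.exp_add, add_neg_cancel, Real.exp_zero, one_mul]
    _ ≤ Real.exp (n * (binEntropy l + l * Real.log 3)) * 1 :=
        mul_le_mul_of_nonneg_left key (Real.exp_pos _).le
    _ = Real.exp (n * (binEntropy l + l * Real.log 3)) := mul_one _

/-! ### The asymptotic quantum Gilbert–Varshamov bound -/

/-- `2^k = e^{k log 2}`. [folklore] -/
private theorem two_pow_eq_exp' (k : ℕ) : (2 : ℝ) ^ k = Real.exp (k * Real.log 2) := by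
  rw [← Real.rpow_natCast, Real.rpow_def_of_pos two_pos, mul_comm]

/-- **The asymptotic quantum Gilbert–Varshamov bound, `R = 1 − δ log₂ 3 − H₂(δ)`.** If
`0 ≤ δ ≤ 3/4`, `0 ≤ R` and `H₂(δ) + δ log₂ 3 ≤ 1 − R` (here in nats:
`binEntropy δ + δ·log 3 ≤ (1 − R)·log 2`), then for EVERY length `n` a pure `[[n, ⌊Rn⌋, ⌈δn⌉]]`
stabilizer code exists: the finite bound `2^k Σ_{j<d} 3^j C(n,j) ≤ 2ⁿ` of
`quantumGilbertVarshamov` holds at every `n` below the GV curve.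
[cite: CalderbankEtAl1997, Thm. 2 (arXiv:quant-ph/9605005 chunk p0005 L104–112: "asymptotic rate R = 1 − 2δ log₂ 3 − H₂(2δ)"); Gottesman1997, §7.1 (chunk p0055 L118–127: "k/n ≥ 1 − 2p log₂ 3 − H(2p)")] -/
theorem quantumGilbertVarshamov_asymptotic {δ R : ℝ} (hδ0 : 0 ≤ δ) (hδ : δ ≤ 3 / 4) (hR : 0 ≤ R)
    (hgv : binEntropy δ + δ * Real.log 3 ≤ (1 - R) * Real.log 2) (n : ℕ) :
    PureAdditiveCodeExists n ⌊R * n⌋₊ ⌈δ * n⌉₊ := by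
  have hlog2 : 0 < Real.log 2 := Real.log_pos one_lt_two
  have hlog3 : 0 ≤ Real.log 3 := Real.log_nonneg (by norm_num)
  have hH : 0 ≤ binEntropy δ := binEntropy_nonneg hδ0 (by linarith)
  have hR1 : R ≤ 1 := by nlinarith
  have hn0 : (0 : ℝ) ≤ n := Nat.cast_nonneg n
  have hkn : ⌊R * n⌋₊ ≤ n := by
    calc ⌊R * n⌋₊ ≤ ⌊(n : ℝ)⌋₊ := Nat.floor_le_floor (by nlinarith)
      _ = n := Nat.floor_natCast n
  refine quantumGilbertVarshamov hkn ?_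
  -- the volume `Σ_{j < ⌈δn⌉} 3^j C(n,j) ≤ Σ_{j ≤ ⌊δn⌋} … ≤ e^{n(H + δ log 3)}`
  have hsub : Finset.range ⌈δ * n⌉₊ ⊆ Finset.range (⌊δ * n⌋₊ + 1) :=
    Finset.range_subset_range.2 (Nat.ceil_le_floor_add_one _)
  have hvol : ((∑ j ∈ Finset.range ⌈δ * n⌉₊, 3 ^ j * n.choose j : ℕ) : ℝ) ≤
      Real.exp (n * (binEntropy δ + δ * Real.log 3)) := by
    calc ((∑ j ∈ Finset.range ⌈δ * n⌉₊, 3 ^ j * n.choose j : ℕ) : ℝ)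
        ≤ ((∑ j ∈ Finset.range (⌊δ * n⌋₊ + 1), 3 ^ j * n.choose j : ℕ) : ℝ) := by
          exact_mod_cast Finset.sum_le_sum_of_subset hsub
      _ = ∑ j ∈ Finset.range (⌊δ * n⌋₊ + 1), (n.choose j : ℝ) * (3 : ℝ) ^ j := by
          push_cast
          exact Finset.sum_congr rfl fun j _ => by ring
      _ ≤ Real.exp (n * (binEntropy δ + δ * Real.log 3)) := sum_choose_mul_three_pow_le_exp n hδ0 hδ
  have hpow : (2 : ℝ) ^ ⌊R * n⌋₊ ≤ Real.exp (R * n * Real.log 2) := by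
    have h1 : (⌊R * n⌋₊ : ℝ) ≤ R * n := Nat.floor_le (by nlinarith)
    rw [two_pow_eq_exp']
    exact Real.exp_le_exp.2 (mul_le_mul_of_nonneg_right h1 hlog2.le)
  have hreal : (2 : ℝ) ^ ⌊R * n⌋₊ * ((∑ j ∈ Finset.range ⌈δ * n⌉₊, 3 ^ j * n.choose j : ℕ) : ℝ) ≤
      (2 : ℝ) ^ n := by
    calc (2 : ℝ) ^ ⌊R * n⌋₊ * ((∑ j ∈ Finset.range ⌈δ * n⌉₊, 3 ^ j * n.choose j : ℕ) : ℝ)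
        ≤ Real.exp (R * n * Real.log 2) * Real.exp (n * (binEntropy δ + δ * Real.log 3)) :=
          mul_le_mul hpow hvol (by positivity) (by positivity)
      _ = Real.exp (R * n * Real.log 2 + n * (binEntropy δ + δ * Real.log 3)) := by
          rw [Real.exp_add]
      _ ≤ Real.exp (n * Real.log 2) := by
          refine Real.exp_le_exp.2 ?_
          have := mul_le_mul_of_nonneg_left hgv hn0
          nlinarith
      _ = (2 : ℝ) ^ n := (two_pow_eq_exp' n).symm
  have hcast : ((2 ^ ⌊R * n⌋₊ * ∑ j ∈ Finset.range ⌈δ * n⌉₊, 3 ^ j * n.choose j : ℕ) : ℝ) ≤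
      ((2 ^ n : ℕ) : ℝ) := by
    simp only [Nat.cast_mul, Nat.cast_pow, Nat.cast_ofNat]
    exact hreal
  exact_mod_cast hcast

/-- **Theorem 2 of [CalderbankEtAl1997] in its printed parametrisation** by the error fraction `p`
(`t = pn` errors corrected, distance `2pn`): if `0 ≤ p ≤ 3/8`, `0 ≤ R` and
`H₂(2p) + 2p log₂ 3 ≤ 1 − R`, then for every `n` a pure `[[n, ⌊Rn⌋, ⌈2pn⌉]]` stabilizer code exists.
[cite: CalderbankEtAl1997, Thm. 2 (chunk p0005 L104–112); Gottesman1997, §7.1 (chunk p0055 L125–127)] -/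
theorem CalderbankEtAl1997_theorem2 {p R : ℝ} (hp0 : 0 ≤ p) (hp : p ≤ 3 / 8) (hR : 0 ≤ R)
    (hgv : binEntropy (2 * p) + 2 * p * Real.log 3 ≤ (1 - R) * Real.log 2) (n : ℕ) :
    PureAdditiveCodeExists n ⌊R * n⌋₊ ⌈2 * p * n⌉₊ :=
  quantumGilbertVarshamov_asymptotic (δ := 2 * p) (by linarith) (by linarith) hR hgv n

end Literature.InformationTheory.QuantumCodes
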